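/-
Copyright (c) 2026 the pub-hodgecm-mathlib formalisation cell (harness21).  Prover seat hodgecm-mathlib-K2E3-p27 (g0), HCML Track B «K2-LIT» ∕ h413
(`stmt-HodgeConjecture-24833`), line `K2_E3_EllipticInputs`, unit U12 «Characters», PART «RANK» leaf (11-2qs-Id′) ∕ (qs2-ps) «van Dijk₂», deal D117 (HCD₂)
(dealer K2E3-plan (g4)), FILE 3 OF 4 «HCD₂-MODEL»: `|D_G|^{−1∕2}` is locally `∫⁻`-finite on the one-place model `U(σ_w, Φ₂)(L_w)` of `U(1,1)(L⁺_v)` — the assembly of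
FILE 1 (Lie algebra) and FILE 2b (group ⟸ Lie) at the CM place, every pin discharged by ★ name.  2026-09-04.
-/
import Summits.HodgeConjecture.HodgeConjecture.Theorems.K2E3U11WeylDiscrGroupToLie        -- FILE 2b (this seat): `exists_nhds_setLIntegral_theta_two_lt_top`; brings ★ `isClosedEmbedding_subtype`
import Summits.HodgeConjecture.HodgeConjecture.Theorems.K2E3U11WeylDiscrLieLocInt         -- ★ FILE 1 p860721 (this seat): `forall_exists_nhds_setLIntegral_etaInv_lt_top_lie_two`
import Summits.HodgeConjecture.HodgeConjecture.Theorems.K2E3CharLocIntNearSemisimpleNonsplitTwoOfQuasiSplitIdentity   -- ★ p860510 (this seat): brings ★ `localNonsplitEquiv`, ★ instances on `(cmDatum …).Local v`, `cmLocalForm`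
import Literature.NumberTheory.Automorphic.QuadraticPlaceDescentPins                       -- ★ (MP): `isClosedEmbedding_algebraMap_adicCompletion_place`, `galAdicCompletionMap_eq_self_iff_mem_range`, `exists_units_galAdicCompletionMap_eq_neg`, `setOf_…_infinite`
import Literature.NumberTheory.LocalFields.FiniteEmbeddingNormAbs                          -- ★ (NB): `normAbs_map_eq_sq_of_involution`
import Literature.NumberTheory.Automorphic.UnitaryGroupInertPlaceHyperbolicBasis           -- ★ `galAdicCompletionMap_galAdicCompletionMap_of_smul_eq` (`σ_w² = 1`)
import Literature.NumberTheory.Automorphic.GaloisActionPlaces                              -- ★ `continuous_galAdicCompletionMap`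
import Literature.NumberTheory.Automorphic.LocalUnitaryGroupCongrMeasure                   -- ★ instances `locallyCompactSpace_cmDatum_local`, `secondCountableTopology_cmDatum_local`
import Literature.NumberTheory.Automorphic.CMLocalRankOneClassMapOpen                      -- ★ `UnitaryGroup.placeForm_antidiagTwo_eq` (`J_w = !![0,1;1,0]`)
import HarnessLib

/-!
# Deal D117 (HCD₂), FILE 3 «HCD₂-MODEL»: `|D_G|^{−1∕2}` is locally `∫⁻`-finite on the one-place model `U(σ_w, Φ₂)(L_w)` (Harish-Chandra 1970 Part VII §1 Thm. 15 for
# `U(1,1)`, in-house)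

Cell `pub/hodgecm-mathlib` (D-0151), Track B «K2-LIT», crux H413 = `stmt-HodgeConjecture-24833`, route `HCCMUnconditional`.  Lane `--supports stmt-HodgeConjecture-24833
--as helper`; THEOREMS ONLY (no `def`, no `instance`, no `notation`, no named-fact hypothesis, no `sorry`); count-neutral.  The `N = 2` twin of the assembly ★
`F0P3cStCharTSHCDModel.exists_nhds_setLIntegral_theta_lt_top_model` + ★ `…HCDModel` ED. 3 `hcd_model` — with NO analytic leaf left open: the Lie-algebra statement is ★ FILE 1
outright (rank one has no Slodowy ∕ descent ∕ cusp leaves).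

WHAT.  `L` CM, `v` a finite place of `L⁺`, `w ∣ v` with `w̄ = w` (so `v` is non-split), `K := L_w`, `σ_w := galAdicCompletionMap c hw`, `J_w := placeForm Φ₂ w = !![0,1;1,0]`
(`Φ₂ = (i, j) ↦ [i + j + 1 = 2]` over `L`; ★ `UnitaryGroup.placeForm_antidiagTwo_eq`), `U′ := U(σ_w, J_w)(L_w) ≤ GL₂(L_w)` — the target of ★
`localNonsplitEquiv c Φ₂ hc w hw : U(Φ₂)(L⁺_v) ≃ₜ* U′`.  HEAD **`hcd₂_model`**: for every Borel structure and Haar measure `ν′` on `U′` and every `g₀ ∈ U′` there is `U ∈ 𝓝 g₀` with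
`∫⁻_U (↑√√(‖disc χ_g‖_w · ‖det g‖_w⁻¹))⁻¹ ∂ν′ < ∞` (the `2 × 2` Weyl-discriminant token `θ₂` of FILE 2).  PINS (all ★): `σ_w` an involution (★ `galAdicCompletionMap_galAdicCompletionMap_of_smul_eq`)
and continuous (★ `continuous_galAdicCompletionMap`); `ι := algebraMap L⁺_v L_w` a closed embedding with `Fix(σ_w) = range ι`, a skew unit, norm-one scalars infinite (★ (MP)
`QuadraticPlaceDescentPins`); the norm bridge (★ (NB)); `CharZero L_w`; the Lie carrier `𝔲 = ker (X ↦ ᵗ(σX)J + JX)` with `borel` and Mathlib `addHaar` (closed in `M₂(L_w)`,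
★ `isClosedEmbedding_subtype`); local compactness ∕ second countability of `U′` transported from the organ carrier along ★ `localNonsplitEquiv`; `ρ := U′.subtype`
(inducing, injective, range = unitary by `Iff.rfl`).  Then ★ FILE 1 feeds ★ FILE 2b.

* §1 `exists_lieCarrier` (any size; the Lie algebra as a kernel), `isUnit_det_placeForm_antidiagTwo` (over ★ `UnitaryGroup.placeForm_antidiagTwo_eq`: `J_w = !![0,1;1,0]`), `mem_range_subtype_two_iff`.
* §2 HEAD **`hcd₂_model`**.  FILE 4 transports it to the organ carrier `G₂` and converts to `LocallyIntegrable (dgFormula₂ L v ·)⁻¹`.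

HONEST LABEL: HC_CM is proved only modulo the 7 printed citations (2 remaining named inputs: hLiu418 = stmt-HodgeConjecture-24832, h413 = stmt-HodgeConjecture-24833) until rung 0
closes; count-neutral helper; closes no socket by itself.

## References
* [HarishChandra1970] Harish-Chandra, *Harmonic analysis on reductive p-adic groups*, LNM 162 (1970), Part VII §1 Thm. 15.
* [Rogawski1990] J. D. Rogawski, *Automorphic Representations of Unitary Groups in Three Variables* (1990), §1.9 p. 13 (`U(1,1)`), §4.9 p. 54 (`D_G`), §12.5 p. 182.
* [PlatonovRapinchuk1994] V. Platonov, A. Rapinchuk, *Algebraic Groups and Number Theory* (1994), §3.3, §5.1.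
* [CasselsFrohlichANT1967] J. W. S. Cassels, A. Fröhlich (eds.), *Algebraic Number Theory* (1967), Ch. II §10, Ch. VII §1.1.
-/

set_option autoImplicit false
set_option linter.dupNamespace false

noncomputable section

open Set Filter MeasureTheory MeasureTheory.Measure TopologicalSpace Topology Matrix ValuativeRel NumberField IsDedekindDomain
open Literature.NumberTheory.Automorphic Literature.NumberTheory.Automorphic.UnitaryGroup Literature.NumberTheory.LocalFields
open Literature.NumberTheory.GaloisRepresentations Literature.NumberTheory.GaloisRepresentations.IsNonarchimedeanLocalField
open Summit.HodgeConjecture.HodgeConjecture.Cruxes.H413.F0P3cStCharTSHCDCayleyChartAt (isClosedEmbedding_subtype)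
open Summit.HodgeConjecture.HodgeConjecture.Cruxes.H413.K2E3U11WeylDiscrGroupToLie (exists_nhds_setLIntegral_theta_two_lt_top)
open Summit.HodgeConjecture.HodgeConjecture.Cruxes.H413.K2E3U11WeylDiscrLieLocInt (forall_exists_nhds_setLIntegral_etaInv_lt_top_lie_two)
open scoped Topology ENNReal NNReal MatrixGroups Matrix

namespace Summit.HodgeConjecture.HodgeConjecture.Cruxes.H413.K2E3U11WeylDiscrModel

/-! ## §1 Carriers and form letters -/

section Generic

variable {K : Type*} [Field K] {m : Type*} [Fintype m]

/-- **The unitary Lie algebra as a kernel** (any matrix size): there is an additive subgroup `𝔲 ≤ M_m(K)` with `X ∈ 𝔲 ↔ ᵗ(σX)·J + J·X = 0` (the kernel of the additive map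
`X ↦ ᵗ(σX)J + JX`; the `3 × 3` reading is ★ `F0P3cStCharTSHCDModel.exists_lieCarrier`). [cite: PlatonovRapinchuk1994, §3.3] -/
theorem exists_lieCarrier (σ : K →+* K) (J : Matrix m m K) :
    ∃ 𝔲 : AddSubgroup (Matrix m m K), ∀ X, X ∈ 𝔲 ↔ (X.map σ)ᵀ * J + J * X = 0 := by
  refine ⟨AddMonoidHom.ker (AddMonoidHom.mk' (fun X : Matrix m m K => (X.map σ)ᵀ * J + J * X) fun X Y => ?_), fun X => ?_⟩
  · rw [Matrix.map_add _ (map_add σ), Matrix.transpose_add, Matrix.add_mul, Matrix.mul_add]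
    abel
  · rw [AddMonoidHom.mem_ker]; rfl

end Generic

section CM

variable (L : Type) [Field L] [NumberField L] [IsCMField L] (v : HeightOneSpectrum (𝓞 ↥(maximalRealSubfield L)))
  (w : PlacesOver L v) (hw : IsCMField.complexConj L • w.1 = w.1)

omit [IsCMField L] in
/-- `det J_w` is a unit (`det !![0,1;1,0] = −1`). [cite: PlatonovRapinchuk1994, §5.1] -/
theorem isUnit_det_placeForm_antidiagTwo :
    IsUnit (placeForm (Matrix.of fun i j : Fin 2 => if i.val + j.val + 1 = 2 then (1 : L) else 0) w.1).det := by
  rw [UnitaryGroup.placeForm_antidiagTwo_eq L v w, Matrix.det_fin_two_of]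
  norm_num

/-- **The range of `U′ ↪ GL₂(L_w)` is the unitary group** (`Iff.rfl` on ★ `unitaryGroupOfForm`). [cite: Rogawski1990, §1.9 p. 13] -/
theorem mem_range_subtype_two_iff (g : GL (Fin 2) (w.1.adicCompletion L)) :
    g ∈ Set.range ((unitaryGroupOfForm (galAdicCompletionMap (L := L) (IsCMField.complexConj L) hw)
        (placeForm (Matrix.of fun i j : Fin 2 => if i.val + j.val + 1 = 2 then (1 : L) else 0) w.1)).subtype) ↔
      (((g : Matrix (Fin 2) (Fin 2) (w.1.adicCompletion L))).map (galAdicCompletionMap (L := L) (IsCMField.complexConj L) hw))ᵀ *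
          placeForm (Matrix.of fun i j : Fin 2 => if i.val + j.val + 1 = 2 then (1 : L) else 0) w.1 * (g : Matrix (Fin 2) (Fin 2) (w.1.adicCompletion L)) =
        placeForm (Matrix.of fun i j : Fin 2 => if i.val + j.val + 1 = 2 then (1 : L) else 0) w.1 := by
  rw [Subgroup.coe_subtype, Subtype.range_coe_subtype]
  exact Iff.rfl

/-! ## §2 HEAD: `θ₂` is locally `∫⁻`-finite on `U(σ_w, Φ₂)(L_w)` -/

set_option maxHeartbeats 1600000 in
-- long binder lists instantiated at the model (same class as the ★ `3 × 3` model head)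
/-- **(HCD₂-MODEL) — `|D_G|^{−1∕2}` IS LOCALLY `∫⁻`-FINITE ON `U(σ_w, Φ₂)(L_w)`**, for every Borel structure and Haar measure `ν′` and every point `g₀`: `∃ U ∈ 𝓝 g₀,
∫⁻_U (↑√√(‖disc χ_g‖_w · ‖det g‖_w⁻¹))⁻¹ ∂ν′ < ∞`.  ASSEMBLY (all ★): `σ_w` involution + continuous; ★ (MP) pins at `w` (closed embedding `ι`, `Fix(σ_w) = range ι`, skew unit `lam`,
norm-one scalars infinite); ★ (NB) norm bridge; `CharZero L_w`, `2 ∈ L_wˣ`; the Lie carrier `𝔲` (§1) with `borel` ∕ `addHaar` (closed in `M₂(L_w)`, ★ `isClosedEmbedding_subtype`);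
★ FILE 1 `forall_exists_nhds_setLIntegral_etaInv_lt_top_lie_two` on `𝔲` (with `J_w = !![0,1;1,0]`, §1); local compactness ∕ second countability of `U′` along ★ `localNonsplitEquiv`
from the organ carrier; ★ FILE 2b `exists_nhds_setLIntegral_theta_two_lt_top` at `G := ↥U′`, `ρ := U′.subtype`.
[cite: HarishChandra1970, Part VII §1 Thm. 15] [cite: Rogawski1990, §4.9 p. 54; §12.5 p. 182] [cite: PlatonovRapinchuk1994, §3.3; §5.1] -/
theorem hcd₂_model
    [MeasurableSpace ↥(unitaryGroupOfForm (galAdicCompletionMap (L := L) (IsCMField.complexConj L) hw)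
      (placeForm (Matrix.of fun i j : Fin 2 => if i.val + j.val + 1 = 2 then (1 : L) else 0) w.1))]
    [BorelSpace ↥(unitaryGroupOfForm (galAdicCompletionMap (L := L) (IsCMField.complexConj L) hw)
      (placeForm (Matrix.of fun i j : Fin 2 => if i.val + j.val + 1 = 2 then (1 : L) else 0) w.1))]
    (ν' : Measure ↥(unitaryGroupOfForm (galAdicCompletionMap (L := L) (IsCMField.complexConj L) hw)
      (placeForm (Matrix.of fun i j : Fin 2 => if i.val + j.val + 1 = 2 then (1 : L) else 0) w.1))) [ν'.IsHaarMeasure]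
    (g₀ : ↥(unitaryGroupOfForm (galAdicCompletionMap (L := L) (IsCMField.complexConj L) hw)
      (placeForm (Matrix.of fun i j : Fin 2 => if i.val + j.val + 1 = 2 then (1 : L) else 0) w.1))) :
    ∃ U ∈ 𝓝 g₀, ∫⁻ g in U,
      ((NNReal.sqrt (NNReal.sqrt (normAbs (w.1.adicCompletion L)
          (((g : ↥(unitaryGroupOfForm (galAdicCompletionMap (L := L) (IsCMField.complexConj L) hw)
              (placeForm (Matrix.of fun i j : Fin 2 => if i.val + j.val + 1 = 2 then (1 : L) else 0) w.1))) :
              GL (Fin 2) (w.1.adicCompletion L)) : Matrix (Fin 2) (Fin 2) (w.1.adicCompletion L)).charpoly.discr *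
        (normAbs (w.1.adicCompletion L)
          (((g : ↥(unitaryGroupOfForm (galAdicCompletionMap (L := L) (IsCMField.complexConj L) hw)
              (placeForm (Matrix.of fun i j : Fin 2 => if i.val + j.val + 1 = 2 then (1 : L) else 0) w.1))) :
              GL (Fin 2) (w.1.adicCompletion L)) : Matrix (Fin 2) (Fin 2) (w.1.adicCompletion L)).det)⁻¹)) : ℝ≥0) : ℝ≥0∞)⁻¹ ∂ν' < ∞ := by
  classical
  have hc : IsCMField.complexConj L ≠ 1 := IsCMField.complexConj_ne_one L
  -- the pins of the one-place model: `σ_w` is a continuous involution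
  have hσσ : ∀ x : w.1.adicCompletion L,
      galAdicCompletionMap (L := L) (IsCMField.complexConj L) hw (galAdicCompletionMap (L := L) (IsCMField.complexConj L) hw x) = x :=
    fun x => galAdicCompletionMap_galAdicCompletionMap_of_smul_eq (IsCMField.complexConj L) w hc hw x
  have hσc : Continuous (galAdicCompletionMap (L := L) (IsCMField.complexConj L) hw) := continuous_galAdicCompletionMap L (IsCMField.complexConj L) hw
  -- the (MP) pins of the place `w`
  have hι := isClosedEmbedding_algebraMap_adicCompletion_place (IsCMField.complexConj L) hc v w hw
  have hιr : ∀ x : w.1.adicCompletion L, galAdicCompletionMap (L := L) (IsCMField.complexConj L) hw x = x ↔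
      x ∈ Set.range (algebraMap (v.adicCompletion ↥(maximalRealSubfield L)) (w.1.adicCompletion L)) :=
    fun x => galAdicCompletionMap_eq_self_iff_mem_range (IsCMField.complexConj L) hc v w hw x
  obtain ⟨lam, hlam⟩ := exists_units_galAdicCompletionMap_eq_neg (IsCMField.complexConj L) hc v w hw
  have hE := setOf_galAdicCompletionMap_mul_self_eq_one_infinite (IsCMField.complexConj L) hc v w hw
  -- characteristic zero, `2 ∈ L_wˣ`
  haveI : CharZero (w.1.adicCompletion L) := charZero_of_injective_algebraMap (algebraMap (L : Type) (w.1.adicCompletion L)).injective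
  have h2 : (2 : w.1.adicCompletion L) ≠ 0 := two_ne_zero
  letI : Invertible (2 : w.1.adicCompletion L) := invertibleOfNonzero h2
  -- the norm bridge ★ (NB)
  have hιn := fun x => normAbs_map_eq_sq_of_involution (algebraMap (v.adicCompletion ↥(maximalRealSubfield L)) (w.1.adicCompletion L)) hι.continuous
    (galAdicCompletionMap (L := L) (IsCMField.complexConj L) hw) hσσ hιr lam hlam x
  -- the form: `J_w = !![0,1;1,0]`, `det J_w` a unit
  have hJeq := UnitaryGroup.placeForm_antidiagTwo_eq L v w
  have hJd := isUnit_det_placeForm_antidiagTwo L v w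
  -- topology of `K = L_w` and `M₂(K)`
  haveI : T2Space (w.1.adicCompletion L) := (IsNonarchimedeanLocalField.isLocalField (w.1.adicCompletion L)).toT2Space
  haveI : LocallyCompactSpace (Matrix (Fin 2) (Fin 2) (w.1.adicCompletion L)) :=
    inferInstanceAs (LocallyCompactSpace (Fin 2 → Fin 2 → w.1.adicCompletion L))
  -- the Lie carrier with its Borel σ-algebra, local compactness and Haar measure
  obtain ⟨𝔲, h𝔲⟩ := exists_lieCarrier (galAdicCompletionMap (L := L) (IsCMField.complexConj L) hw)
    (placeForm (Matrix.of fun i j : Fin 2 => if i.val + j.val + 1 = 2 then (1 : L) else 0) w.1)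
  letI : MeasurableSpace ↥𝔲 := borel _
  haveI : BorelSpace ↥𝔲 := ⟨rfl⟩
  haveI : LocallyCompactSpace ↥𝔲 :=
    (isClosedEmbedding_subtype (galAdicCompletionMap (L := L) (IsCMField.complexConj L) hw)
      (placeForm (Matrix.of fun i j : Fin 2 => if i.val + j.val + 1 = 2 then (1 : L) else 0) w.1) 𝔲 hσc h𝔲).locallyCompactSpace
  -- the same carrier read with the literal form `!![0,1;1,0]` (for ★ FILE 1)
  have h𝔲' : ∀ X, X ∈ 𝔲 ↔ (X.map (galAdicCompletionMap (L := L) (IsCMField.complexConj L) hw))ᵀ * !![(0 : w.1.adicCompletion L), 1; 1, 0] +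
      !![(0 : w.1.adicCompletion L), 1; 1, 0] * X = 0 := fun X => by rw [h𝔲 X, hJeq]
  -- ★ FILE 1: the Lie-algebra statement on `𝔲(1,1)`
  have hLie := forall_exists_nhds_setLIntegral_etaInv_lt_top_lie_two (galAdicCompletionMap (L := L) (IsCMField.complexConj L) hw) hσσ
    (algebraMap (v.adicCompletion ↥(maximalRealSubfield L)) (w.1.adicCompletion L)) hι hιr lam hlam hιn 𝔲 h𝔲' (addHaar : Measure ↥𝔲)
  -- the group `U′`: local compactness and second countability from the organ carrier along ★ `localNonsplitEquiv`
  have e := (localNonsplitEquiv (IsCMField.complexConj L) (Matrix.of fun i j : Fin 2 => if i.val + j.val + 1 = 2 then (1 : L) else 0) hc w hw :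
    ((cmDatum L 2 (Matrix.of fun i j : Fin 2 => if i.val + j.val + 1 = 2 then (1 : L) else 0)).Local v) ≃ₜ*
      ↥(unitaryGroupOfForm (galAdicCompletionMap (L := L) (IsCMField.complexConj L) hw)
        (placeForm (Matrix.of fun i j : Fin 2 => if i.val + j.val + 1 = 2 then (1 : L) else 0) w.1)))
  haveI : LocallyCompactSpace ↥(unitaryGroupOfForm (galAdicCompletionMap (L := L) (IsCMField.complexConj L) hw)
      (placeForm (Matrix.of fun i j : Fin 2 => if i.val + j.val + 1 = 2 then (1 : L) else 0) w.1)) :=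
    e.symm.toHomeomorph.isClosedEmbedding.locallyCompactSpace
  haveI : SecondCountableTopology ↥(unitaryGroupOfForm (galAdicCompletionMap (L := L) (IsCMField.complexConj L) hw)
      (placeForm (Matrix.of fun i j : Fin 2 => if i.val + j.val + 1 = 2 then (1 : L) else 0) w.1)) :=
    e.symm.toHomeomorph.secondCountableTopology
  -- ★ FILE 2b at `G := ↥U′`, `ρ := U′.subtype`
  exact exists_nhds_setLIntegral_theta_two_lt_top (galAdicCompletionMap (L := L) (IsCMField.complexConj L) hw)
    (placeForm (Matrix.of fun i j : Fin 2 => if i.val + j.val + 1 = 2 then (1 : L) else 0) w.1) 𝔲 (addHaar : Measure ↥𝔲)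
    ((unitaryGroupOfForm (galAdicCompletionMap (L := L) (IsCMField.complexConj L) hw)
      (placeForm (Matrix.of fun i j : Fin 2 => if i.val + j.val + 1 = 2 then (1 : L) else 0) w.1)).subtype) ν'
    hσc h2 hJd h𝔲 IsInducing.subtypeVal Subtype.val_injective (mem_range_subtype_two_iff L v w hw) hE hLie g₀

end CM

end Summit.HodgeConjecture.HodgeConjecture.Cruxes.H413.K2E3U11WeylDiscrModel

end
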